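import Summits.RiemannHypothesis.RiemannHypothesis.Theorems.PfPersistenceDefectiveTransportCoarse
import Summits.RiemannHypothesis.RiemannHypothesis.Theorems.PfPersistenceDefectiveTransportCalibration
import HarnessLib

/-!
# No transport of the FULL Weil bottom needs the seed: unguarded relative clauses freeze
# negativity (leaf G1.22 TRANSPORT, part 7a)

pub-rhpf cell (mechanism/rigidity campaign; **no RH claims**), seat `pub-rhpf-transport-1` gen 7.
Companion of parts 2 (`…Calibration`), 4 (`…AnyBase`) and 6 (`…Coarse`).

Write `ε = weilGroundEnergy` (the bottom of Weil's quadratic functional on the window `[-a, a]`;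
antitone in `a`).  Leaf G1.22 is the programme "transport the PROVED positivity `ε(a₀) > 0`,
`a₀ < (log 3)/2`, to large windows by a Grönwall law".  Part 4 showed that every GRADED member
(defect `C e^{δa}`, `δ > 0`) needs no seed and lands on `quasi-RH(δ/2)`, and recorded the residual
belief that the seed "matters only for the defect-free member `C = 0` (positivity transport)".  This
file shows that the seed matters for NO member: the defect-free members are RH from ANY single base
`b > 0`, whatever the (unknown) sign of `ε b`.

The mechanism is one line.  A relative clause that is UNGUARDED (asserted at every window of the
range, not only where `ε > 0`) with a non-negative rate (`K ≥ 0`, as in parts 1/2/4) says, at a window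
where `ε ≤ 0`, that `ε` cannot drop at all (`K ε x ≤ 0`); since `ε` is antitone, negativity is FROZEN:
`ε a ≥ min (ε b) 0` for all `a ≥ b` (`min_le_of_dini`, `ge_min_of_leakage_anyBase`).  An eventually
bounded-below Weil bottom is RH (Solo's `riemannHypothesis_iff_weilGroundEnergy_bddBelow` /
`riemannHypothesis_of_weilGroundEnergy_subexp`, in the tree since 2026-08-17).  Hence:

1. **K-clause from any base ⟺ RH** (`riemannHypothesis_of_leakage_anyBase`,
   `leakage_anyBase_iff_riemannHypothesis`): for EVERY `b > 0`, the per-compact-range lower-right-Dini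
   clause `ε x − ε (x + h) ≤ h (K ε x + η)` (`K ≥ 0` per range `[b, A)`) holds from `b` iff RH.  The
   converse is part 2 (`defectiveLeakageFrom_of_riemannHypothesis` with `C = 0`).  Part 1's
   `riemannHypothesis_of_diniLeakageFrom` asked `a₀ < (log 3)/2`; the hypothesis is superfluous.
   (A second proof: with `C = 0` the clause is part 4's clause at EVERY rate `δ`, so part 4's
   `riemannHypothesis_of_defectiveLeakage_all` applies verbatim — part 4 already contained the fact.)
2. **Transport kernels and gauges from one base** (`riemannHypothesis_of_boundedTransport_anyBase`,
   `strip_half_of_expTransport_anyBase`, `riemannHypothesis_of_monotoneOn_mulGauge_anyBase`,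
   `riemannHypothesis_of_archTransport_anyBase`, `riemannHypothesis_of_archTransport_anyBase'`):
   `ε b · F a ≤ ε a` (`a ≥ b`) with `0 ≤ F ≤ M` gives RH; with `0 ≤ F a ≤ M e^{δa}` it gives
   `|Re ρ − 1/2| ≤ δ/2`; a positive non-decreasing gauge `G` with `G·ε` non-decreasing on `[b, ∞)`
   gives RH — in particular the cell's DATA law MONO-F (`a ↦ e^{4πe^{2a}} ε a` non-decreasing) from
   ANY base is RH, with no seed (part 0's `riemannHypothesis_of_archTransportFrom'` asked
   `a₀ < (log 3)/2`).  Compare the tree's `riemannHypothesis_of_nonneg_transport` (transport from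
   EVERY base, unbounded kernel): one base and a bounded kernel suffice.
3. **Where the RH-content of a relative clause sits — the trichotomy, kernel-visible**
   (`guardedRateBound_of_nonpos`, `anySignLeakage_of_neg`, item 1): a relative law says something
   about zeros only through what it asserts at windows with `ε ≤ 0`.  GUARDED laws (asked only where
   `ε > 0`, the shape of part 0's `riemannHypothesis_of_rateBoundFrom`) hold VACUOUSLY from any base
   with `ε b ≤ 0` — they need the seed; UNGUARDED laws with a rate of EITHER sign hold from any base
   with `ε b < 0` by REGULARITY alone (the tree's `WindowLipschitz`, RH-free) — no zero content;
   UNGUARDED laws with `K ≥ 0` are RH from every base.  So for the full bottom the PROVED small-window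
   base of leaf G1.22 is load-bearing for no typed transport input: relative unguarded members are RH
   from anywhere, graded members are quasi-RH(rate/2) from anywhere (part 4), guarded members are RH
   with the seed and empty without it.  The seed is essential only for the PARITY quantity
   `ε₋ − ε₊` (parts `…ParityTransport`, `…RatioTransport`, `…CellChain`), which is not monotone.

The companion file `…RateZero` (part 7b) adds the COARSE relative clause from one base and the
rate-zero rung `RH ⟺ uniformly bounded drops over one fixed step, eventually` (seed-free, elementary).

Every statement is elementary real analysis over tree theorems; every member is a typed HYPOTHESIS
(asserted nowhere) or an RH-labelled calibration (proof.conditional; credits nothing).  References: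
E. Bombieri, *Remarks on Weil's quadratic functional in the theory of prime numbers I*, Rend. Mat.
Acc. Lincei (9) 11 (2000) 183–233, §4; H. Yoshida, *On Hermitian forms attached to zeta functions*,
Adv. Stud. Pure Math. 21 (1992) 281–325; A. Connes, C. Consani, H. Moscovici, arXiv:2511.22755,
Cor. 3.7–3.8 (monotonicity of the bottom; "limit `0` ⟹ RH"). [folklore]
-/

noncomputable section

set_option linter.dupNamespace false  -- D-0017 nested layout: `RiemannHypothesis.RiemannHypothesis`

namespace Summit.RiemannHypothesis.RiemannHypothesis.Theorems.PfPersistenceDefectiveTransport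

open Set
open _root_.Literature.NumberTheory.LFunctions
open _root_.Summit.RiemannHypothesis.RiemannHypothesis.Theorems.WeilWindowFlowDiniLeakage
  (mul_exp_le_of_dini continuousOn_weilGroundEnergy_Icc)
open _root_.Summit.RiemannHypothesis.RiemannHypothesis.Theorems.WeilWindowFlowWindowLipschitz
  (windowLipschitz_antitone WindowLipschitz_proof)

/-! ## 1. Real analysis: an unguarded relative Dini clause with `K ≥ 0` freezes negativity -/

/-- **Freezing lemma.**  If `f` is continuous on `[b, c]` and satisfies the lower-right-Dini clause
`f x − f (x + h) ≤ h (K f x + η)` (arbitrarily small `h > 0`, every `η > 0`) at every `x ∈ [b, c)` with a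
NON-NEGATIVE rate `K`, then `min (f b) 0 ≤ f x` on `[b, c]` — whatever the sign of `f b`.  (Grönwall
fence `mul_exp_le_of_dini` applied to `f − min (f b) 0 + θ`, which satisfies the same clause because
`K ≥ 0`.) [folklore] -/
theorem min_le_of_dini {f : ℝ → ℝ} {b c K : ℝ} (hf : ContinuousOn f (Icc b c)) (hK : 0 ≤ K)
    (hD : ∀ x ∈ Ico b c, ∀ η δ : ℝ, 0 < η → 0 < δ →
      ∃ h : ℝ, 0 < h ∧ h < δ ∧ f x - f (x + h) ≤ h * (K * f x + η)) :
    ∀ x ∈ Icc b c, min (f b) 0 ≤ f x := by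
  intro x hx
  have hm0 : min (f b) 0 ≤ 0 := min_le_right _ _
  have hmb : min (f b) 0 ≤ f b := min_le_left _ _
  refine le_of_forall_pos_le_add fun θ hθ ↦ ?_
  have hgc : ContinuousOn (fun y ↦ f y - min (f b) 0 + θ) (Icc b c) :=
    (hf.sub continuousOn_const).add continuousOn_const
  have hgb : 0 < f b - min (f b) 0 + θ := by linarith
  have hgD : ∀ y ∈ Ico b c, ∀ η δ : ℝ, 0 < η → 0 < δ → ∃ h : ℝ, 0 < h ∧ h < δ ∧
      (f y - min (f b) 0 + θ) - (f (y + h) - min (f b) 0 + θ) ≤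
        h * (K * (f y - min (f b) 0 + θ) + η) := by
    intro y hy η δ hη hδ
    obtain ⟨h, hh, hhδ, hle⟩ := hD y hy η δ hη hδ
    refine ⟨h, hh, hhδ, ?_⟩
    have h1 : K * f y ≤ K * (f y - min (f b) 0 + θ) :=
      mul_le_mul_of_nonneg_left (by linarith) hK
    have h2 : h * (K * f y + η) ≤ h * (K * (f y - min (f b) 0 + θ) + η) :=
      mul_le_mul_of_nonneg_left (by linarith) hh.le
    linarith
  have key := mul_exp_le_of_dini (f := fun y ↦ f y - min (f b) 0 + θ) hgc hgb hgD x hx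
  have hpos : 0 < (f b - min (f b) 0 + θ) * Real.exp (-(K * (x - b))) :=
    mul_pos hgb (Real.exp_pos _)
  have h3 : 0 < f x - min (f b) 0 + θ := hpos.trans_le key
  linarith

/-! ## 2. The K-clause (unguarded, `K ≥ 0`, no defect) from ANY base is RH -/

/-- **Unguarded relative leakage from any base freezes negativity.**  If from some base `b > 0` the
per-compact-range K-clause holds — for every `A ≥ b` some `K ≥ 0` with
`ε x − ε (x + h) ≤ h (K ε x + η)` for arbitrarily small `h > 0` at every `x ∈ [b, A)`, `η > 0` — then
`min (ε b) 0 ≤ ε a` for every `a ≥ b`: the bottom never goes below its (possibly negative) value at the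
base.  No seed, no sign condition on `ε b`.  CONDITIONAL; RH-free; no RH claim. [folklore] -/
theorem ge_min_of_leakage_anyBase {b : ℝ} (hb : 0 < b)
    (h : ∀ A : ℝ, b ≤ A → ∃ K : ℝ, 0 ≤ K ∧ ∀ x ∈ Ico b A, ∀ η δ' : ℝ, 0 < η → 0 < δ' →
      ∃ h : ℝ, 0 < h ∧ h < δ' ∧
        weilGroundEnergy x - weilGroundEnergy (x + h) ≤ h * (K * weilGroundEnergy x + η)) :
    ∀ a : ℝ, b ≤ a → min (weilGroundEnergy b) 0 ≤ weilGroundEnergy a := by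
  intro a hba
  obtain ⟨K, hK, hKx⟩ := h a hba
  exact min_le_of_dini (continuousOn_weilGroundEnergy_Icc hb) hK hKx a ⟨hba, le_rfl⟩

/-- **An eventual CONSTANT floor is RH** (the rate-`0` case of Solo's exact thermometer: a constant
slack is sub-exponential slack, `riemannHypothesis_of_weilGroundEnergy_subexp`).  CONDITIONAL;
proof.conditional; no RH claim. [folklore] -/
theorem riemannHypothesis_of_eventual_const_floor {b C : ℝ} (hb : 0 < b)
    (h : ∀ a : ℝ, b ≤ a → -C ≤ weilGroundEnergy a) : _root_.RiemannHypothesis := by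
  refine riemannHypothesis_of_weilGroundEnergy_subexp fun κ hκ ↦ ⟨max C 0, b, fun a hba ↦ ?_⟩
  have h1 : (1 : ℝ) ≤ Real.exp (κ * a) := Real.one_le_exp (by nlinarith [hb.trans_le hba])
  have h2 := h a hba
  have h3 : C ≤ max C 0 * Real.exp (κ * a) :=
    (le_max_left C 0).trans (le_mul_of_one_le_right (le_max_right _ _) h1)
  linarith

/-- **RH ⟺ the bottom is EVENTUALLY bounded below** (`∃ b > 0, ∃ C, ∀ a ≥ b, −C ≤ ε a`; Solo's
`riemannHypothesis_iff_weilGroundEnergy_bddBelow` asks all `a > 0` — the same by antitonicity).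
proof.conditional both ways; credits nothing; no RH claim. [folklore] -/
theorem riemannHypothesis_iff_eventually_bddBelow :
    _root_.RiemannHypothesis ↔
      ∃ b C : ℝ, 0 < b ∧ ∀ a : ℝ, b ≤ a → -C ≤ weilGroundEnergy a := by
  constructor
  · intro hRH
    exact ⟨1, 0, one_pos, fun a ha ↦ by
      simpa using weilGroundEnergy_nonneg_of_riemannHypothesis hRH (by linarith)⟩
  · rintro ⟨b, C, hb, h⟩
    exact riemannHypothesis_of_eventual_const_floor hb h

/-- **The K-clause from ANY base `b > 0` implies RH — no seed.**  (Part 1's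
`riemannHypothesis_of_diniLeakageFrom` asked `0 < a₀ < (log 3)/2`; that hypothesis is superfluous:
negativity is frozen by `ge_min_of_leakage_anyBase`, and an eventually bounded-below bottom is RH.)
CONDITIONAL — the clause is asserted nowhere; no RH claim. [folklore] -/
theorem riemannHypothesis_of_leakage_anyBase {b : ℝ} (hb : 0 < b)
    (h : ∀ A : ℝ, b ≤ A → ∃ K : ℝ, 0 ≤ K ∧ ∀ x ∈ Ico b A, ∀ η δ' : ℝ, 0 < η → 0 < δ' →
      ∃ h : ℝ, 0 < h ∧ h < δ' ∧
        weilGroundEnergy x - weilGroundEnergy (x + h) ≤ h * (K * weilGroundEnergy x + η)) :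
    _root_.RiemannHypothesis :=
  riemannHypothesis_of_eventual_const_floor hb (C := -min (weilGroundEnergy b) 0) fun a hba ↦ by
    have h1 := ge_min_of_leakage_anyBase hb h a hba
    linarith

/-- **K-clause from any base ⟺ RH, for every single base `b > 0`.**  (`→`: the theorem above;
`←`: part 2's `defectiveLeakageFrom_of_riemannHypothesis` with defect `C = 0`, i.e. the tree's
`DiniLeakage` under RH via `WindowLipschitz`, plus `ε ≥ 0`.)  The PROVED small-window positivity of
leaf G1.22 plays no role on either side.  proof.conditional both ways; credits nothing; no RH claim.
[folklore] -/
theorem leakage_anyBase_iff_riemannHypothesis {b : ℝ} (hb : 0 < b) :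
    (∀ A : ℝ, b ≤ A → ∃ K : ℝ, 0 ≤ K ∧ ∀ x ∈ Ico b A, ∀ η δ' : ℝ, 0 < η → 0 < δ' →
      ∃ h : ℝ, 0 < h ∧ h < δ' ∧
        weilGroundEnergy x - weilGroundEnergy (x + h) ≤ h * (K * weilGroundEnergy x + η)) ↔
    _root_.RiemannHypothesis := by
  constructor
  · exact riemannHypothesis_of_leakage_anyBase hb
  · intro hRH A hA
    obtain ⟨K, hK, hKx⟩ := defectiveLeakageFrom_of_riemannHypothesis hRH hb le_rfl 0 A hA
    refine ⟨K, hK, fun x hx η δ' hη hδ' ↦ ?_⟩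
    obtain ⟨h, hh, hhδ, hle⟩ := hKx x hx η δ' hη hδ'
    exact ⟨h, hh, hhδ, by simpa using hle⟩

/-! ## 3. Transport kernels and multiplicative gauges from ONE base -/

/-- **A BOUNDED non-negative transport kernel from one base is RH.**  If for some `b > 0` and all
`a ≥ b`: `ε b · F a ≤ ε a` with `0 ≤ F a ≤ M`, then RH — whatever the sign of `ε b`
(`ε a ≥ −|ε b|·max M 0`).  Compare the tree's `riemannHypothesis_of_nonneg_transport` (transport from
EVERY base, kernel unbounded) and part 0's `riemannHypothesis_of_transportFrom` (one SEED base
`a₀ < (log 3)/2`, kernel `> 0`).  CONDITIONAL; no RH claim. [folklore] -/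
theorem riemannHypothesis_of_boundedTransport_anyBase {b M : ℝ} (hb : 0 < b) {F : ℝ → ℝ}
    (hF0 : ∀ a : ℝ, b ≤ a → 0 ≤ F a) (hFM : ∀ a : ℝ, b ≤ a → F a ≤ M)
    (h : ∀ a : ℝ, b ≤ a → weilGroundEnergy b * F a ≤ weilGroundEnergy a) :
    _root_.RiemannHypothesis := by
  refine riemannHypothesis_of_eventual_const_floor hb (C := |weilGroundEnergy b| * max M 0)
    fun a hba ↦ ?_
  have h1 := h a hba
  have h2 : -(|weilGroundEnergy b| * max M 0) ≤ weilGroundEnergy b * F a := by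
    rcases le_or_gt 0 (weilGroundEnergy b) with hε | hε
    · have h3 : 0 ≤ weilGroundEnergy b * F a := mul_nonneg hε (hF0 a hba)
      have h4 : 0 ≤ |weilGroundEnergy b| * max M 0 := by positivity
      linarith
    · have hFa : F a ≤ max M 0 := (hFM a hba).trans (le_max_left _ _)
      have h3 : weilGroundEnergy b * max M 0 ≤ weilGroundEnergy b * F a :=
        mul_le_mul_of_nonpos_left hFa hε.le
      rw [abs_of_neg hε]
      linarith
  linarith

/-- **An exponentially growing kernel from one base gives a strip of half its rate.**  If for some
`b > 0` and all `a ≥ b`: `ε b · F a ≤ ε a` with `0 ≤ F a ≤ M e^{δa}` (`δ ≥ 0`), then every non-trivial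
zero has `|Re ρ − 1/2| ≤ δ/2` (floor `−|ε b|·max M 0·e^{δa}`, Solo's
`abs_re_sub_half_le_of_weilGroundEnergy_exp_lower`; no positivity of `b` is needed).  The growth rate
of the kernel is the rate of the floor; a bounded kernel is the rate-`0` case above.  CONDITIONAL; no
RH claim. [folklore] -/
theorem strip_half_of_expTransport_anyBase {b M δ : ℝ} (hδ : 0 ≤ δ) {F : ℝ → ℝ}
    (hF0 : ∀ a : ℝ, b ≤ a → 0 ≤ F a) (hFM : ∀ a : ℝ, b ≤ a → F a ≤ M * Real.exp (δ * a))
    (h : ∀ a : ℝ, b ≤ a → weilGroundEnergy b * F a ≤ weilGroundEnergy a)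
    {ρ : ℂ} (hρ : ρ ∈ ZetaZeros.riemannZetaNontrivialZeros) : |ρ.re - 1 / 2| ≤ δ / 2 := by
  refine abs_re_sub_half_le_of_weilGroundEnergy_exp_lower (κ := δ)
    (C := |weilGroundEnergy b| * max M 0) (a₀ := b) hδ (fun a hba ↦ ?_) hρ
  have h1 := h a hba
  have hE : 0 < Real.exp (δ * a) := Real.exp_pos _
  have h2 : -(|weilGroundEnergy b| * max M 0 * Real.exp (δ * a)) ≤ weilGroundEnergy b * F a := by
    rcases le_or_gt 0 (weilGroundEnergy b) with hε | hε
    · have h3 : 0 ≤ weilGroundEnergy b * F a := mul_nonneg hε (hF0 a hba)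
      have h4 : 0 ≤ |weilGroundEnergy b| * max M 0 * Real.exp (δ * a) := by positivity
      linarith
    · have hFa : F a ≤ max M 0 * Real.exp (δ * a) :=
        (hFM a hba).trans (mul_le_mul_of_nonneg_right (le_max_left _ _) hE.le)
      have h3 : weilGroundEnergy b * (max M 0 * Real.exp (δ * a)) ≤ weilGroundEnergy b * F a :=
        mul_le_mul_of_nonpos_left hFa hε.le
      rw [abs_of_neg hε]
      linarith
  linarith

/-- **A positive non-decreasing multiplicative gauge from one base is RH.**  If `G > 0` is
non-decreasing on `[b, ∞)` (`b > 0`) and `a ↦ G a · ε a` is non-decreasing on `[b, ∞)`, then RH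
(kernel `F a = G b / G a ∈ [0, 1]`).  No seed.  CONDITIONAL; no RH claim. [folklore] -/
theorem riemannHypothesis_of_monotoneOn_mulGauge_anyBase {b : ℝ} (hb : 0 < b) {G : ℝ → ℝ}
    (hG0 : ∀ a : ℝ, b ≤ a → 0 < G a) (hGmono : MonotoneOn G (Ici b))
    (h : MonotoneOn (fun a ↦ G a * weilGroundEnergy a) (Ici b)) : _root_.RiemannHypothesis := by
  refine riemannHypothesis_of_boundedTransport_anyBase hb (M := 1) (F := fun a ↦ G b / G a)
    (fun a hba ↦ div_nonneg (hG0 b le_rfl).le (hG0 a hba).le) (fun a hba ↦ ?_) (fun a hba ↦ ?_)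
  · have hGa := hG0 a hba
    have hle : G b ≤ G a := hGmono (self_mem_Ici : b ∈ Ici b) (mem_Ici.2 hba) hba
    rw [div_le_iff₀ hGa, one_mul]
    exact hle
  · have hGa := hG0 a hba
    have h1 : G b * weilGroundEnergy b ≤ G a * weilGroundEnergy a :=
      h (self_mem_Ici : b ∈ Ici b) (mem_Ici.2 hba) hba
    have e : weilGroundEnergy b * (G b / G a) = G b * weilGroundEnergy b / G a := by ring
    rw [e, div_le_iff₀ hGa]
    linarith

/-- **MONO-F from ANY base is RH.**  If `a ↦ exp (4π e^{2a}) · ε a` is non-decreasing on `[b, ∞)`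
for some `b > 0` (the cell's archimedean rate law MONO-F, TRANSPORT.md T-B, read from `b` on), then
RH — with no seed window (part 0's `riemannHypothesis_of_archTransportFrom'` asked `a₀ < (log 3)/2`).
DATA label of MONO-F unchanged (ζ satisfies it on the served ladder); CONDITIONAL; no RH claim.
[folklore] -/
theorem riemannHypothesis_of_archTransport_anyBase {b : ℝ} (hb : 0 < b)
    (h : MonotoneOn (fun a ↦ Real.exp (4 * Real.pi * Real.exp (2 * a)) * weilGroundEnergy a)
      (Ici b)) : _root_.RiemannHypothesis :=
  riemannHypothesis_of_monotoneOn_mulGauge_anyBase hb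
    (G := fun a ↦ Real.exp (4 * Real.pi * Real.exp (2 * a))) (fun _ _ ↦ Real.exp_pos _)
    (fun x _ y _ hxy ↦ Real.exp_le_exp.2
      (mul_le_mul_of_nonneg_left (Real.exp_le_exp.2 (by linarith)) (by positivity))) h

/-- **Quasi-monotone MONO-F from ANY base is RH** (the integrated law of record T-B∫ with its
constant `c > 0`, read from an arbitrary base `b > 0`):
`c · ε b · exp (−4π (e^{2a} − e^{2b})) ≤ ε a` for `a ≥ b` implies RH (kernel bounded by `c`).  No seed.
CONDITIONAL; no RH claim. [folklore] -/
theorem riemannHypothesis_of_archTransport_anyBase' {b c : ℝ} (hb : 0 < b) (hc : 0 < c)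
    (h : ∀ a : ℝ, b ≤ a →
      c * weilGroundEnergy b * Real.exp (-(4 * Real.pi * (Real.exp (2 * a) - Real.exp (2 * b)))) ≤
        weilGroundEnergy a) :
    _root_.RiemannHypothesis := by
  refine riemannHypothesis_of_boundedTransport_anyBase hb (M := c)
    (F := fun a ↦ c * Real.exp (-(4 * Real.pi * (Real.exp (2 * a) - Real.exp (2 * b)))))
    (fun _ _ ↦ (mul_pos hc (Real.exp_pos _)).le) (fun a hba ↦ ?_) (fun a hba ↦ ?_)
  · have h1 : Real.exp (-(4 * Real.pi * (Real.exp (2 * a) - Real.exp (2 * b)))) ≤ 1 := by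
      rw [Real.exp_le_one_iff]
      have : Real.exp (2 * b) ≤ Real.exp (2 * a) := Real.exp_le_exp.2 (by linarith)
      nlinarith [Real.pi_pos]
    simpa using mul_le_mul_of_nonneg_left h1 hc.le
  · have e : weilGroundEnergy b *
        (c * Real.exp (-(4 * Real.pi * (Real.exp (2 * a) - Real.exp (2 * b))))) =
        c * weilGroundEnergy b * Real.exp (-(4 * Real.pi * (Real.exp (2 * a) - Real.exp (2 * b)))) := by
      ring
    rw [e]
    exact h a hba

/-! ## 4. Where the RH-content of a relative clause sits: the two clause shapes with NO content -/

/-- **GUARDED relative laws are EMPTY past a non-positive window.**  The rate bound of part 0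
(`riemannHypothesis_of_rateBoundFrom`: `−ε′ ≤ K ε` asked only at windows where `0 < ε`) holds from any
base `b > 0` with `ε b ≤ 0`, for EVERY rate function `K` — vacuously, by antitonicity.  So a guarded law
transports nothing without a seed; with the seed it is RH (part 0).  RH-free; no RH claim. [folklore] -/
theorem guardedRateBound_of_nonpos {b : ℝ} (hb : 0 < b) (hε : weilGroundEnergy b ≤ 0) (K : ℝ → ℝ) :
    ∀ a : ℝ, b ≤ a → 0 < weilGroundEnergy a → DifferentiableAt ℝ weilGroundEnergy a →
      -deriv weilGroundEnergy a ≤ K a * weilGroundEnergy a := by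
  intro a hba hpos _
  have h1 : weilGroundEnergy a ≤ weilGroundEnergy b := windowLipschitz_antitone hb hba
  exact absurd (h1.trans hε) (not_le.2 hpos)

/-- **UNGUARDED relative laws with a rate of EITHER sign are mere REGULARITY at a negative base.**
If `ε b < 0` (`b > 0`), then from `b` the per-compact-range Dini clause
`ε x − ε (x + h) ≤ h (K ε x + η)` holds with SOME real `K` (a negative one) on every `[b, A)` — by the
tree's PROVED one-sided local Lipschitz bound `WindowLipschitz` alone (RH-free): take
`K = (L + 1)/ε b` with `L ≥ 0` the Lipschitz constant on `[b, A + 1]`, so that `K ε x ≥ L + 1` for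
`x ≥ b`.  Hence the sign restriction `K ≥ 0` of parts 1/2/4 is exactly what carries the RH-content of
the K-clause at non-positive windows (items `ge_min_of_leakage_anyBase`,
`leakage_anyBase_iff_riemannHypothesis`).  RH-free; no RH claim. [folklore] -/
theorem anySignLeakage_of_neg {b : ℝ} (hb : 0 < b) (hε : weilGroundEnergy b < 0) :
    ∀ A : ℝ, b ≤ A → ∃ K : ℝ, ∀ x ∈ Ico b A, ∀ η δ' : ℝ, 0 < η → 0 < δ' →
      ∃ h : ℝ, 0 < h ∧ h < δ' ∧
        weilGroundEnergy x - weilGroundEnergy (x + h) ≤ h * (K * weilGroundEnergy x + η) := by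
  intro A hA
  obtain ⟨L, hL⟩ := WindowLipschitz_proof b (A + 1) hb (by linarith)
  refine ⟨(max L 0 + 1) / weilGroundEnergy b, fun x hx η δ' hη hδ' ↦ ?_⟩
  refine ⟨min (δ' / 2) (1 / 2), by positivity,
    (min_le_left _ _).trans_lt (by linarith), ?_⟩
  set h : ℝ := min (δ' / 2) (1 / 2) with hh
  have hhpos : 0 < h := by positivity
  have hh1 : h ≤ 1 / 2 := min_le_right _ _
  have hLip := hL x (x + h) hx.1 (by linarith) (by linarith [hx.2])
  -- `K ε x ≥ max L 0 + 1`
  have hεx : weilGroundEnergy x ≤ weilGroundEnergy b := windowLipschitz_antitone hb hx.1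
  have hratio : 1 ≤ weilGroundEnergy x / weilGroundEnergy b := by
    rw [le_div_iff_of_neg hε]
    linarith
  have hK : max L 0 + 1 ≤ (max L 0 + 1) / weilGroundEnergy b * weilGroundEnergy x := by
    have e : (max L 0 + 1) / weilGroundEnergy b * weilGroundEnergy x =
        (max L 0 + 1) * (weilGroundEnergy x / weilGroundEnergy b) := by ring
    rw [e]
    exact le_mul_of_one_le_right (by positivity) hratio
  have h1 : L * (x + h - x) = h * L := by ring
  rw [h1] at hLip
  have h2 : h * L ≤ h * ((max L 0 + 1) / weilGroundEnergy b * weilGroundEnergy x + η) := by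
    apply mul_le_mul_of_nonneg_left _ hhpos.le
    linarith [le_max_left L 0]
  linarith

end Summit.RiemannHypothesis.RiemannHypothesis.Theorems.PfPersistenceDefectiveTransport

end
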